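import Summits.Ventures.PercRepro.Night2GoodTwoThreeColoops

/-!
# night-2: a good target has at most one coloop off `K`

A good point `x` of a lossy big set `Q` lies in at most one of the three thin hyperplanes `clF (Q.erase w)` of `Q`
(`gtPts`).  Since the three coloops of `Q ∖ K` are exactly the three thin faces (`card_coloops_eq_three_of_loss_ne_zero`),
every coloop `w` of `Q ∖ K` whose hyperplane misses `x` is restored in `insert x Q` — `rk (insert x (Q.erase w)) = 6` — so
the good target `insert x Q` keeps at most one coloop off `K`.  Consequently the `dshGT2` shares of the first tier land
on targets with at most one coloop off `K` only, the range of `dload_gt_le_cap2_of_card_coloops_le_one'''`.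
-/

namespace PercRepro.Shadow

open PercRepro.ThmH PercRepro.PerFlat

variable {α : Type*} [DecidableEq α] {M : Matroid α} [M.Finite] {G : Finset α}

/-- Closure off a coloop `e₀` of `G`: a point `y ≠ e₀` of `G` in `clF X` lies in `clF (X.erase e₀)`. -/
theorem mem_clF_erase_coloop_of_mem_clF (hG : G ∈ flatsQ M (5 + 1)) {e₀ : α} (he₀ : e₀ ∈ coloops M G)
    {X : Finset α} (hXG : X ⊆ G) {y : α} (hyG : y ∈ G) (hye : y ≠ e₀) (hy : y ∈ clF M X) :
    y ∈ clF M (X.erase e₀) := by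
  have hGg : G ⊆ gr M := (mem_flatsQ.1 hG).1
  by_cases he₀X : e₀ ∈ X
  · by_contra hyn
    have hXe : X.erase e₀ ⊆ gr M := (Finset.erase_subset _ _).trans (hXG.trans hGg)
    have r1 := rkN_insert_of_notMem_clF (hGg hyG) hyn
    have hsub : insert y (X.erase e₀) ⊆ G.erase e₀ := by
      intro a ha
      rw [Finset.mem_insert] at ha
      rcases ha with rfl | ha
      · exact Finset.mem_erase.2 ⟨hye, hyG⟩
      · exact Finset.mem_erase.2 ⟨(Finset.mem_erase.1 ha).1, hXG (Finset.mem_erase.1 ha).2⟩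
    have he₀n : e₀ ∉ clF M (insert y (X.erase e₀)) :=
      fun h => (mem_coloops.1 he₀).2 (clF_mono hsub h)
    have r2 := rkN_insert_of_notMem_clF (hGg (mem_coloops.1 he₀).1) he₀n
    have heq : insert e₀ (insert y (X.erase e₀)) = insert y X := by
      rw [Finset.insert_comm, Finset.insert_erase he₀X]
    rw [heq, r1] at r2
    have r3 := rkN_insert_le_of_mem_clF (hXG.trans hGg) hy
    have hcol : e₀ ∈ coloops M X := mem_coloops_of_subset hXG he₀ he₀X
    have r4 := rkN_sdiff_add_card_of_subset_coloops (M := M) (hXG.trans hGg)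
      (Finset.singleton_subset_iff.2 hcol)
    rw [Finset.sdiff_singleton_eq_erase, Finset.card_singleton] at r4
    omega
  · rw [Finset.erase_eq_of_notMem he₀X]
    exact hy

/-- A point off `K` that is a coloop of `S ∖ K` is a coloop of `S` (cell `(2, 1)`). -/
theorem mem_coloops_of_mem_coloops_sdiff (hG : G ∈ flatsQ M (5 + 1)) (hk : kColoops M G = 1)
    {S : Finset α} (hSG : S ⊆ G) {u : α} (hu : u ∈ coloops M (S \ coloops M G)) : u ∈ coloops M S := by
  obtain ⟨e₀, he₀⟩ := Finset.card_eq_one.1 (show (coloops M G).card = 1 by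
    rw [← kColoops_eq_card_coloops]; exact hk)
  have he₀c : e₀ ∈ coloops M G := he₀ ▸ Finset.mem_singleton_self e₀
  rw [mem_coloops, Finset.mem_sdiff, he₀, Finset.mem_singleton] at hu
  rw [mem_coloops]
  refine ⟨hu.1.1, fun hcl => hu.2 ?_⟩
  have h := mem_clF_erase_coloop_of_mem_clF hG he₀c (Finset.erase_subset_iff_of_mem (hSG hu.1.1) |>.2 hSG)
    (hSG hu.1.1) hu.1.2 hcl
  have heq : (S.erase u).erase e₀ = (S \ {e₀}).erase u := by
    rw [Finset.sdiff_singleton_eq_erase, Finset.erase_right_comm]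
  rw [heq] at h
  exact h

/-- The thin faces of a lossy big set are exactly the erasures of its three coloops off `K`. -/
theorem thinFacesOf_eq_image_erase (hG : G ∈ flatsQ M (5 + 1)) (hd : (gr M \ G).card = 2)
    (hk : kColoops M G = 1) (hs : ∀ e ∈ gr M, ∀ f ∈ gr M, e ≠ f → rkN M {e, f} = 2)
    (hl : ∀ e ∈ gr M, M.Indep {e}) {B : Finset α} (hB : B ∈ thinMembers M 5 G)
    (hbig : 5 ≤ (B \ coloops M G).card) {z : α} (hz : z ∈ G \ clF M B) (h : loss M 5 G B z ≠ 0) :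
    thinFacesOf M 5 G (insert z B) =
      (coloops M (insert z B \ coloops M G)).image (fun w => (insert z B).erase w) := by
  have hd' : (gr M \ G).card ≤ 5 := by omega
  have hsub : thinFacesOf M 5 G (insert z B) ⊆
      (coloops M (insert z B \ coloops M G)).image (fun w => (insert z B).erase w) :=
    thin_coverPreimages_subset_image_coloops hG hd' (insert z B)
  have h3 := card_coloops_eq_three_of_loss_ne_zero hG hd hk hs hl hB hbig hz h
  have hQG : insert z B ⊆ G :=
    Finset.insert_subset (Finset.mem_sdiff.1 hz).1 (subset_G_of_mem_thinMembers hB)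
  have hcap := capS_ge_eleven_eighteenths_two_one hd hk hQG
  have hL : ¬ L1 M 5 G (insert z B) ≤ capS M 5 G (insert z B) := by
    intro hle
    apply h
    unfold loss fS
    rw [if_pos hle]
    ring
  have hL1 : L1 M 5 G (insert z B) ≤ ((thinFacesOf M 5 G (insert z B)).card : ℚ) * (7 / 24) := by
    unfold L1 thinFacesOf
    calc ∑ F ∈ (coverPreimages M (Uq M (5 + 2) 5) G (insert z B)).filter (fun F => F ∉ lay0 M 5 G), req M 5 F
        ≤ ∑ _F ∈ (coverPreimages M (Uq M (5 + 2) 5) G (insert z B)).filter (fun F => F ∉ lay0 M 5 G),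
            (7 / 24 : ℚ) := by
          apply Finset.sum_le_sum
          intro F hF
          rw [Finset.mem_filter, mem_coverPreimages] at hF
          exact req_le_seven_div_24_of_thin hG hd (mem_thinMembers.2 ⟨hF.1.1, hF.2⟩)
      _ = _ := by rw [Finset.sum_const, nsmul_eq_mul]
  have hcard3 : 3 ≤ (thinFacesOf M 5 G (insert z B)).card := by
    by_contra hlt
    push Not at hlt
    have h2 : ((thinFacesOf M 5 G (insert z B)).card : ℚ) ≤ 2 := by exact_mod_cast (by omega : _ ≤ 2)
    exact hL (by linarith)
  apply Finset.eq_of_subset_of_card_le hsub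
  calc ((coloops M (insert z B \ coloops M G)).image (fun w => (insert z B).erase w)).card
      ≤ (coloops M (insert z B \ coloops M G)).card := Finset.card_image_le
    _ = 3 := h3
    _ ≤ (thinFacesOf M 5 G (insert z B)).card := hcard3

/-- **A good target has at most one coloop off `K`.** -/
theorem card_coloops_le_one_of_mem_gtPts (hG : G ∈ flatsQ M (5 + 1)) (hd : (gr M \ G).card = 2)
    (hk : kColoops M G = 1) (hs : ∀ e ∈ gr M, ∀ f ∈ gr M, e ≠ f → rkN M {e, f} = 2)
    (hl : ∀ e ∈ gr M, M.Indep {e}) {B : Finset α} (hB : B ∈ thinMembers M 5 G)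
    (hbig : 5 ≤ (B \ coloops M G).card) {z : α} (hz : z ∈ G \ clF M B) (h : loss M 5 G B z ≠ 0)
    {x : α} (hx : x ∈ gtPts M 5 G (insert z B)) :
    (coloops M (insert x (insert z B) \ coloops M G)).card ≤ 1 := by
  have hd' : (gr M \ G).card ≤ 5 := by omega
  have hGg : G ⊆ gr M := (mem_flatsQ.1 hG).1
  have hKB : coloops M G ⊆ B := coloops_subset_of_mem_thinMembers hG hd' hB
  have hBG : B ⊆ G := subset_G_of_mem_thinMembers hB
  have hzG : z ∈ G := (Finset.mem_sdiff.1 hz).1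
  have hzcl : z ∉ clF M B := (Finset.mem_sdiff.1 hz).2
  have hQG : insert z B ⊆ G := Finset.insert_subset hzG hBG
  have hKQ : coloops M G ⊆ insert z B := hKB.trans (Finset.subset_insert _ _)
  have hKG : coloops M G ⊆ G := fun e he => (mem_coloops.1 he).1
  -- ranks: `rk Q = 6`, `rk (Q ∖ K) = 5`, `rk (G ∖ K) = 5`
  have hrQ : rkN M (insert z B) = 6 := by
    rw [rkN_insert_of_notMem_clF (hGg hzG) hzcl, rkN_eq_five_of_mem_thinMembers hB]
  have hrQs : rkN M (insert z B \ coloops M G) = 5 := by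
    have := rkN_eq_rkN_sdiff_add_one hG hk (S := insert z B) hQG (Finset.Subset.refl _) hKQ
    omega
  have hrGs : rkN M (G \ coloops M G) = 5 := by
    have := rkN_eq_rkN_sdiff_add_one hG hk (S := G) (Finset.Subset.refl _) (Finset.Subset.refl _) hKG
    rw [rkN_eq_of_mem_flatsQ hG] at this
    omega
  simp only [gtPts, Finset.mem_filter, Finset.mem_sdiff] at hx
  have hxG : x ∈ G := hx.1.1
  have hxQ : x ∉ insert z B := hx.1.2
  have hxK : x ∉ coloops M G := fun hxK => hxQ (hKQ hxK)
  have hxQs : x ∉ insert z B \ coloops M G := fun h' => hxQ (Finset.mem_sdiff.1 h').1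
  have hfaces := thinFacesOf_eq_image_erase hG hd hk hs hl hB hbig hz h
  have hSeq : insert x (insert z B) \ coloops M G = insert x (insert z B \ coloops M G) :=
    Finset.insert_sdiff_of_notMem _ hxK
  have hSG : insert x (insert z B) ⊆ G := Finset.insert_subset hxG hQG
  -- `x ∈ clF (Q ∖ K)`: ranks are `5` on both sides
  have hxcl : x ∈ clF M (insert z B \ coloops M G) := by
    have hsubG : insert x (insert z B \ coloops M G) ⊆ G \ coloops M G :=
      Finset.insert_subset (Finset.mem_sdiff.2 ⟨hxG, hxK⟩) (Finset.sdiff_subset_sdiff hQG (Finset.Subset.refl _))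
    have h1 := rkN_mono (M := M) hsubG
    have h2 := rkN_mono (M := M) (Finset.subset_insert x (insert z B \ coloops M G))
    rw [hrGs] at h1
    rw [hrQs] at h2
    exact mem_clF_of_rkN_eq (Finset.subset_insert _ _) (hsubG.trans (Finset.sdiff_subset.trans hGg))
      (by rw [hrQs]; omega) (Finset.mem_insert_self _ _)
  -- every coloop of `S ∖ K` is a coloop of `Q ∖ K` whose hyperplane contains `x`
  have hsub : coloops M (insert x (insert z B) \ coloops M G) ⊆
      (coloops M (insert z B \ coloops M G)).filter (fun w => x ∈ clF M ((insert z B).erase w)) := by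
    intro u hu
    rw [Finset.mem_filter]
    have hu' := hu
    rw [mem_coloops, hSeq] at hu'
    have hux : u ≠ x := by
      rintro rfl
      apply hu'.2
      rw [Finset.erase_insert hxQs]
      exact hxcl
    have huQs : u ∈ insert z B \ coloops M G := by
      rcases Finset.mem_insert.1 hu'.1 with h' | h'
      · exact absurd h' hux
      · exact h'
    have hucol : u ∈ coloops M (insert z B \ coloops M G) := by
      rw [mem_coloops]
      exact ⟨huQs, fun hc => hu'.2 (clF_mono (Finset.erase_subset_erase _ (Finset.subset_insert _ _)) hc)⟩
    refine ⟨hucol, ?_⟩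
    by_contra hxn
    have hface : (insert z B).erase u ∈ thinFacesOf M 5 G (insert z B) := by
      rw [hfaces]
      exact Finset.mem_image_of_mem _ hucol
    have hthin : (insert z B).erase u ∈ thinMembers M 5 G := by
      unfold thinFacesOf at hface
      rw [Finset.mem_filter, mem_coverPreimages] at hface
      exact mem_thinMembers.2 ⟨hface.1.1, hface.2⟩
    have r5 := rkN_eq_five_of_mem_thinMembers hthin
    have r6 := rkN_insert_of_notMem_clF (hGg hxG) hxn
    have hSerase : (insert x (insert z B)).erase u = insert x ((insert z B).erase u) :=
      Finset.erase_insert_of_ne hux.symm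
    have hrS : rkN M (insert x (insert z B)) = 6 := by
      have h1 := rkN_mono (M := M) (Finset.erase_subset u (insert x (insert z B)))
      have h2 := rkN_mono (M := M) hSG
      rw [rkN_eq_of_mem_flatsQ hG] at h2
      rw [hSerase, r6, r5] at h1
      omega
    have huS : u ∈ insert x (insert z B) := Finset.mem_insert_of_mem (Finset.mem_sdiff.1 huQs).1
    have hucl : u ∈ clF M ((insert x (insert z B)).erase u) :=
      mem_clF_of_rkN_eq (Finset.erase_subset _ _) (hSG.trans hGg) (by rw [hSerase, r6, r5, hrS]) huS
    exact (mem_coloops.1 (mem_coloops_of_mem_coloops_sdiff hG hk hSG hu)).2 hucl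
  calc (coloops M (insert x (insert z B) \ coloops M G)).card
      ≤ ((coloops M (insert z B \ coloops M G)).filter
          (fun w => x ∈ clF M ((insert z B).erase w))).card := Finset.card_le_card hsub
    _ ≤ ((thinFacesOf M 5 G (insert z B)).filter (fun F => x ∈ clF M F)).card := by
        apply Finset.card_le_card_of_injOn (fun w => (insert z B).erase w)
        · intro w hw
          simp only [Finset.mem_coe, Finset.mem_filter] at hw ⊢
          exact ⟨by rw [hfaces]; exact Finset.mem_image_of_mem _ hw.1, hw.2⟩
        · intro w hw w' hw' heq
          simp only [Finset.mem_coe, Finset.mem_filter] at hw hw'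
          have hw'Q : w' ∈ insert z B := (Finset.mem_sdiff.1 (mem_coloops.1 hw'.1).1).1
          by_contra hne
          have hmem : w' ∈ (insert z B).erase w := Finset.mem_erase.2 ⟨Ne.symm hne, hw'Q⟩
          simp only at heq
          rw [heq] at hmem
          exact (Finset.mem_erase.1 hmem).1 rfl
    _ ≤ 1 := hx.2

/-- **A good target of a lossy big pair has at most one coloop off `K`** — the first tier of `dshGT2` (and of
`dshGT`) loads only targets in the range of `dload_gt_le_cap2_of_card_coloops_le_one'''`. -/
theorem card_coloops_le_one_of_mem_gtTargets (hG : G ∈ flatsQ M (5 + 1)) (hd : (gr M \ G).card = 2)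
    (hk : kColoops M G = 1) (hs : ∀ e ∈ gr M, ∀ f ∈ gr M, e ≠ f → rkN M {e, f} = 2)
    (hl : ∀ e ∈ gr M, M.Indep {e}) {B : Finset α} (hB : B ∈ thinMembers M 5 G)
    (hbig : 5 ≤ (B \ coloops M G).card) {z : α} (hz : z ∈ G \ clF M B) (h : loss M 5 G B z ≠ 0)
    {S : Finset α} (hS : S ∈ gtTargets M 5 G B z) : (coloops M (S \ coloops M G)).card ≤ 1 := by
  unfold gtTargets at hS
  rw [Finset.mem_image] at hS
  obtain ⟨x, hx, rfl⟩ := hS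
  exact card_coloops_le_one_of_mem_gtPts hG hd hk hs hl hB hbig hz h hx

end PercRepro.Shadow
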